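import Literature.AnabelianGeometry.AbsoluteAnabelian.AbsTopICharacterRankPoincareExtension
import HarnessLib

/-!
# [AbsTopI] Lemma 4.5 (iii), Poincaré-extension form — NON-VACUITY at a closed datum

Proof-only companion of `AbsTopICharacterRankPoincareExtension.lean` (S. Mochizuki, *Topics in Absolute
Anabelian Geometry I: Generalities* [MochizukiAbsTopI2012], Lemma 4.5 (iii), kurims manuscript p. 54;
[CombGC] = [MochizukiCombGC2007] Prop. 1.3 p. 9, Prop. 2.4 (ii)(iii)(vii) pp. 19–20, Cor. 2.7 (i) proof
p. 23), cell abc-iut, block F, seat abc-iut-f-062 (FACT-LIST schemata F-0222 · F-0223 · F-0224).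
The hypotheses of the Poincaré-extension theorems — a stable NONZERO quasi-toral `C ≤ V`, a representation
on `V ⧸ C` intertwined by `C.mkQ`, a `G`-equivariant nondegenerate `χ^{cyclo}`-valued pairing on `V ⧸ C`,
non-degenerate `χ^{cyclo}`, `dim V > 0` — are JOINTLY INHABITED: `G = ℤ` (written multiplicatively,
discrete), `K = ℚ`, `χ^{cyclo}(n) = 4ⁿ`, `ψ(n) = 2ⁿ`, `V = ℚ × ℚ` with `n ↦ (4ⁿ·x, 2ⁿ·y)` (pinned to
the term `twist (withTrivial (twist 1 (χ^{cyclo}ψ⁻¹))) ψ` by `hV`), `C = ℚ × 0 = ker snd`, pairing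
`B(p, q) = snd(p)·snd(q)` on `V/C ≅ ℚ(ψ)` (`ψ² = χ^{cyclo}`) — the shape of `T_l` of a twice-punctured
genus-"½" toy (`r = dim C + 1 = 2` cusps); all conclusions of the sequel hold there
(`PoincareInt42Model.lem45iii_all`), so its hypothesis set is consistent.  No new definitions.
HONEST FRAMING: an algebraic toy, consistency evidence only — not a curve; nothing here bears on
[IUTchIII] Cor. 3.12.
-/

noncomputable section

open scoped Classical

namespace Literature.AnabelianGeometry.AbsoluteAnabelian.AbsTopI

namespace PoincareInt42Model

/-- The model representation, evaluated: `n ↦ (4ⁿ·x, 2ⁿ·y)`. [cite: MochizukiAbsTopI2012, Lemma 4.5 (iii) p.54] -/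
theorem rho_apply (ρV : Multiplicative ℤ →* ((ℚ × ℚ) ≃ₗ[ℚ] (ℚ × ℚ)))
    (hV : ρV = twist (withTrivial (twist (1 : Multiplicative ℤ →* (ℚ ≃ₗ[ℚ] ℚ))
      ((zpowersHom ℚˣ (Units.mk0 (4 : ℚ) (by positivity))) *
        (zpowersHom ℚˣ (Units.mk0 (2 : ℚ) (by positivity)))⁻¹)))
      (zpowersHom ℚˣ (Units.mk0 (2 : ℚ) (by positivity))))
    (g : Multiplicative ℤ) (x : ℚ × ℚ) :
    ρV g x = (((zpowersHom ℚˣ (Units.mk0 (4 : ℚ) (by positivity))) g : ℚ) * x.1,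
      ((zpowersHom ℚˣ (Units.mk0 (2 : ℚ) (by positivity))) g : ℚ) * x.2) := by
  rw [hV, twist_withTrivial_apply, twist_one_smul_apply, smul_smul, smul_eq_mul, smul_eq_mul,
    ← Units.val_mul, MonoidHom.mul_apply, MonoidHom.inv_apply, mul_comm (_ : ℚˣ) (_ * _),
    inv_mul_cancel_right]

/-- **NON-VACUITY of the Poincaré-extension hypotheses, with all conclusions of the sequel**: at the
closed datum (`V = ℚ × ℚ`, `C = ker snd = ℚ × 0` quasi-toral of rank `1`, `V/C ≅ ℚ(ψ)` self-dual via
`snd · snd` since `ψ² = χ^{cyclo}`) A3, A7, A9 (`r = 2`), the three sentences of Lemma 4.5 (iii) and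
`d_{χ^{cyclo}}(V) = 1` hold — obtained by APPLYING the general theorems, whose hypotheses are thereby
jointly consistent (with `C ≠ 0`, `χ^{cyclo}` non-degenerate, `dim V > 0`).
[cite: MochizukiAbsTopI2012, Lemma 4.5 (iii) p.54] [cite: MochizukiCombGC2007, Prop. 2.4 (vii) p.20] -/
theorem lem45iii_all (ρV : Multiplicative ℤ →* ((ℚ × ℚ) ≃ₗ[ℚ] (ℚ × ℚ)))
    (hV : ρV = twist (withTrivial (twist (1 : Multiplicative ℤ →* (ℚ ≃ₗ[ℚ] ℚ))
      ((zpowersHom ℚˣ (Units.mk0 (4 : ℚ) (by positivity))) *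
        (zpowersHom ℚˣ (Units.mk0 (2 : ℚ) (by positivity)))⁻¹)))
      (zpowersHom ℚˣ (Units.mk0 (2 : ℚ) (by positivity)))) :
    DetSqQuasiCyclotomic (zpowersHom ℚˣ (Units.mk0 (4 : ℚ) (by positivity))) ρV ∧
      RealisedWeightsSymmetric (zpowersHom ℚˣ (Units.mk0 (4 : ℚ) (by positivity))) ρV ∧
      CuspCountViaWeights (zpowersHom ℚˣ (Units.mk0 (4 : ℚ) (by positivity))) ρV 2 ∧
      Lem45iii_det (zpowersHom ℚˣ (Units.mk0 (4 : ℚ) (by positivity))) ρV ∧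
      Lem45iii_cycloClass (zpowersHom ℚˣ (Units.mk0 (4 : ℚ) (by positivity))) ρV ∧
      Lem45iii_cuspCount (zpowersHom ℚˣ (Units.mk0 (4 : ℚ) (by positivity))) ρV 2 ∧
      dChi ρV (zpowersHom ℚˣ (Units.mk0 (4 : ℚ) (by positivity))) = 1 := by
  set χ : Multiplicative ℤ →* ℚˣ := zpowersHom ℚˣ (Units.mk0 (4 : ℚ) (by positivity)) with hχ
  set ψ : Multiplicative ℤ →* ℚˣ := zpowersHom ℚˣ (Units.mk0 (2 : ℚ) (by positivity)) with hψ
  have hψ2 : ∀ g, ψ g ^ 2 = χ g := Int42Model.psi_sq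
  have hcyc := nondegenerate_zpowersHom (x := (4 : ℚ)) (by norm_num)
  have hρ : ∀ (g : Multiplicative ℤ) (x : ℚ × ℚ), ρV g x = ((χ g : ℚ) * x.1, (ψ g : ℚ) * x.2) :=
    rho_apply ρV hV
  -- the cuspidal line `C = ℚ × 0`
  set C : Submodule ℚ (ℚ × ℚ) := LinearMap.ker (LinearMap.snd ℚ ℚ ℚ) with hCdef
  have hmemC : ∀ x : ℚ × ℚ, x ∈ C ↔ x.2 = 0 := fun x => by
    rw [hCdef, LinearMap.mem_ker, LinearMap.snd_apply]
  have hC : IsStable ρV C := by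
    intro g x hx
    rw [hmemC] at hx ⊢
    rw [hρ, hx, mul_zero]
  have hC0 : C ≠ ⊥ := by
    intro h
    have h1 : ((1 : ℚ), (0 : ℚ)) ∈ C := (hmemC _).2 rfl
    rw [h, Submodule.mem_bot, Prod.mk_eq_zero] at h1
    exact one_ne_zero h1.1
  have hCt : ∃ U : Subgroup (Multiplicative ℤ), IsOpen (U : Set (Multiplicative ℤ)) ∧ U.FiniteIndex ∧
      ∀ g ∈ U, ∀ c ∈ C, ρV g c = (χ g : ℚ) • c := by
    refine ⟨⊤, isOpen_univ, inferInstance, fun g _ c hc => ?_⟩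
    rw [hmemC] at hc
    rw [hρ, Prod.smul_mk, smul_eq_mul, smul_eq_mul, hc, mul_zero, mul_zero]
  have hdimC : Module.finrank ℚ C = 1 := by
    rw [hCdef, LinearMap.ker_snd, LinearMap.finrank_range_of_inj LinearMap.inl_injective,
      Module.finrank_self]
  have hdimV : 0 < Module.finrank ℚ (ℚ × ℚ) := by simp
  -- the quotient representation and the pairing `B(p, q) = snd p · snd q`
  obtain ⟨ρP, hρP⟩ := exists_quotientRepresentation ρV hC
  let φ : ((ℚ × ℚ) ⧸ C) →ₗ[ℚ] ℚ := C.liftQ (LinearMap.snd ℚ ℚ ℚ) le_rfl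
  have hφ : ∀ x : ℚ × ℚ, φ (C.mkQ x) = x.2 := fun x => Submodule.liftQ_apply _ _ _
  let B : ((ℚ × ℚ) ⧸ C) →ₗ[ℚ] ((ℚ × ℚ) ⧸ C) →ₗ[ℚ] ℚ := (LinearMap.mul ℚ ℚ).compl₁₂ φ φ
  have hBapp : ∀ x y : ℚ × ℚ, B (C.mkQ x) (C.mkQ y) = x.2 * y.2 := fun x y => by
    show LinearMap.mul ℚ ℚ (φ (C.mkQ x)) (φ (C.mkQ y)) = x.2 * y.2
    rw [LinearMap.mul_apply', hφ, hφ]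
  have hB : ∀ (g : Multiplicative ℤ) (p q : (ℚ × ℚ) ⧸ C), B (ρP g p) (ρP g q) = (χ g : ℚ) * B p q := by
    intro g p q
    obtain ⟨x, rfl⟩ := C.mkQ_surjective p
    obtain ⟨y, rfl⟩ := C.mkQ_surjective q
    rw [hρP, hρP, hBapp, hBapp, hρ, hρ, ← hψ2 g, Units.val_pow_eq_pow_val]
    ring
  have hBl : ∀ p : (ℚ × ℚ) ⧸ C, (∀ q, B p q = 0) → p = 0 := by
    intro p hp
    obtain ⟨x, rfl⟩ := C.mkQ_surjective p
    have h1 := hp (C.mkQ ((0 : ℚ), (1 : ℚ)))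
    rw [hBapp, mul_one] at h1
    exact (Submodule.Quotient.mk_eq_zero C).2 ((hmemC x).2 h1)
  have hA7 := realisedWeightsSymmetric_of_poincareExtension χ hcyc ρV hC hC0 hCt ρP hρP B hB hBl
  have hA9 := cuspCountViaWeights_of_poincareExtension χ hcyc ρV hC hCt ρP hρP B hB hBl
  have hA3 := detSqQuasiCyclotomic_of_poincareExtension χ ρV hdimV hC hCt ρP hρP B hB hBl
  have h1 := lem45iii_det_of_poincareExtension χ ρV hdimV hC hCt ρP hρP B hB hBl
  have h2 := lem45iii_cycloClass_of_poincareExtension χ hcyc ρV hC hC0 hCt ρP hρP B hB hBl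
  have h3 := lem45iii_cuspCount_of_poincareExtension χ hcyc ρV hC hCt ρP hρP B hB hBl
  have h4 := dChi_of_poincareExtension χ hcyc ρV hC hCt ρP hρP B hB hBl
  rw [hdimC] at hA9 h3 h4
  exact ⟨hA3, hA7, hA9, h1, h2, h3, by exact_mod_cast h4⟩

end PoincareInt42Model

end Literature.AnabelianGeometry.AbsoluteAnabelian.AbsTopI

end
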